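import Summits.CriticalPhenomena.PercolationContinuityZ3.Theorems.PercNearOneGluingNoHeavyLowerTailCovTauMetaA2
import HarnessLib

/-!
# META-A2, ABSTRACT FORM — the van den Berg–Häggström–Kahn / Ahlswede–Daykin two-source induction for FOUR world functionals

Support file (`--supports stmt-CriticalPhenomena-4575`), prover `prim-ineq-gen-7` (gen 8).  No definitions, no named facts, no sorries.
Memo `prim-ineq-gen-7/Q9-WRITEUP.md` Lemma 5.1 (= [W] `prim-hp-8/CSH-WRITEUP.md` Lemma 4.3); blueprint `PROOF-Q9-MIXED-CSH.md` §10 (bricks B3, B4).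

`CovTau.metaA2_of_star` (prim-hp-4) runs the two-source induction for the SPECIFIC observer functional `E_A(N) = μ_{G[U]}(o ∈ C_v, v ↮ A ∪ N)`
and a generic pure functional `Y_F`.  The mixed conditioned slack hierarchy (Kozma–Nitzan Question 9 / Conjecture 6 for every `|A|`, memo Theorem M1)
needs the same induction for OTHER first functionals (the hub functional `μ(Σ ∩ C_v ≠ ∅, Σ ↮ A ∪ N, v ↮ A ∪ N)` of (Htw-mix), and the "gain from an external
gadget" functional of Lemma R⁻).  This file abstracts the induction once and for all:

* `CovTau.metaA2_abstract` — four families `f₁ … f₄ : Finset V → Set V → ℝ` ("world `U'`, source set `N` ↦ `⟨f_i⟩^{U'}_N`"), nonnegative, each obeying the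
  STAR DECOMPOSITION `f U' N = Σ_ω weight(ω)·f (U' ∖ Z) ((N ∖ Z) ∪ S_Z(ω))` at every admissible nonempty `Z ⊆ N` (BHK's identity (6); admissibility `Adm U' Z` is an
  abstract side condition implied by `f₁ U' N · f₂ U' N' ≠ 0` for `Z ⊆ N ∩ N'`), with `⟨f₁⟩, ⟨f₂⟩` antitone in `N` and the DISJOINT-sources bound
  `⟨f₁⟩_N ⟨f₂⟩_{N'} ≤ ⟨f₃⟩_{N∪N'} · f₄(U', ∅)`; CONCLUSION: `⟨f₁⟩_N ⟨f₂⟩_{N'} ≤ ⟨f₃⟩_{N∪N'} ⟨f₄⟩_{N∩N'}` for all `N, N' ⊆ U`.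
  Proof = verbatim the induction of `CovTau.metaA2_of_star`: strong induction on `U`; `N ∩ N' = ∅` is the hypothesis; otherwise decompose at `Z = N ∩ N'`,
  push forward to the product law of the neighbour set (`CovTau.sum_weight_rS`) and apply Ahlswede–Daykin (`four_functions_theorem_univ`) with the induction
  hypothesis in `U ∖ Z` at the pair `P = S ∪ ((N∖Z)∖T)`, `P' = T ∪ ((N'∖Z)∖S)`.
Instances: `(Eav, Yw F, Mav, Xw F)` recovers `metaA2_of_star`; the two mixed instances are bricks B3/B4 of the blueprint.
[cite: VandenbergHaggstromKahn2005, Thm. 1.1 (pp. 3–5), §1 identity (6) (p. 4)] [cite: KozmaNitzan2024, Question 9 (§5.5 p. 36)]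
-/

noncomputable section

namespace Summit.CriticalPhenomena.PercolationContinuityZ3.Theorems.CovTau

open Literature.Probability.Percolation
open Literature.Probability.Percolation.BHK2006
open Literature.Probability.Percolation.DecisionTree (ind ind_of_mem ind_of_not_mem ind_nonneg)
open scoped Classical

variable {V : Type*} [Fintype V]

/-- **META-A2, abstract four-functional form** — see the module docstring.
[cite: VandenbergHaggstromKahn2005, Thm. 1.1 (pp. 3–5), §1 identity (6) (p. 4)] -/
theorem metaA2_abstract (w : Sym2 V → ℝ) (hw0 : ∀ e, 0 ≤ w e) (hw1 : ∀ e, w e ≤ 1)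
    (hm : ∑ ω, weight w ω = 1) (Adm : Finset V → Finset V → Prop)
    (f₁ f₂ f₃ f₄ : Finset V → Set V → ℝ)
    (h₁ : ∀ U' N, 0 ≤ f₁ U' N) (h₂ : ∀ U' N, 0 ≤ f₂ U' N) (h₃ : ∀ U' N, 0 ≤ f₃ U' N) (h₄ : ∀ U' N, 0 ≤ f₄ U' N)
    (U : Finset V)
    (hadm : ∀ U' ⊆ U, ∀ N N' : Set V, N ⊆ ↑U' → N' ⊆ ↑U' → f₁ U' N * f₂ U' N' ≠ 0 →
      ∀ Z ⊆ U', (↑Z : Set V) ⊆ N ∩ N' → Adm U' Z)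
    (hstep₁ : ∀ U' ⊆ U, ∀ Z ⊆ U', Adm U' Z → Z.Nonempty → ∀ N : Set V, (↑Z : Set V) ⊆ N → N ⊆ ↑U' →
      f₁ U' N = ∑ ω, weight w ω * f₁ (U' \ Z) ((N \ ↑Z) ∪ rS U' Z ω))
    (hstep₂ : ∀ U' ⊆ U, ∀ Z ⊆ U', Adm U' Z → Z.Nonempty → ∀ N : Set V, (↑Z : Set V) ⊆ N → N ⊆ ↑U' →
      f₂ U' N = ∑ ω, weight w ω * f₂ (U' \ Z) ((N \ ↑Z) ∪ rS U' Z ω))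
    (hstep₃ : ∀ U' ⊆ U, ∀ Z ⊆ U', Adm U' Z → Z.Nonempty → ∀ N : Set V, (↑Z : Set V) ⊆ N → N ⊆ ↑U' →
      f₃ U' N = ∑ ω, weight w ω * f₃ (U' \ Z) ((N \ ↑Z) ∪ rS U' Z ω))
    (hstep₄ : ∀ U' ⊆ U, ∀ Z ⊆ U', Adm U' Z → Z.Nonempty → ∀ N : Set V, (↑Z : Set V) ⊆ N → N ⊆ ↑U' →
      f₄ U' N = ∑ ω, weight w ω * f₄ (U' \ Z) ((N \ ↑Z) ∪ rS U' Z ω))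
    (hanti₁ : ∀ U' ⊆ U, ∀ N N' : Set V, N ⊆ N' → N' ⊆ ↑U' → f₁ U' N' ≤ f₁ U' N)
    (hanti₂ : ∀ U' ⊆ U, ∀ N N' : Set V, N ⊆ N' → N' ⊆ ↑U' → f₂ U' N' ≤ f₂ U' N)
    (hbase : ∀ U' ⊆ U, ∀ N N' : Set V, N ⊆ ↑U' → N' ⊆ ↑U' → N ∩ N' = ∅ →
      f₁ U' N * f₂ U' N' ≤ f₃ U' (N ∪ N') * f₄ U' ∅) :
    ∀ N N' : Set V, N ⊆ ↑U → N' ⊆ ↑U →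
      f₁ U N * f₂ U N' ≤ f₃ U (N ∪ N') * f₄ U (N ∩ N') := by
  induction U using Finset.strongInduction with
  | H U ih =>
  intro N N' hNU hN'U
  have hRHS : 0 ≤ f₃ U (N ∪ N') * f₄ U (N ∩ N') := mul_nonneg (h₃ _ _) (h₄ _ _)
  -- trivial case: the left-hand side vanishes
  by_cases h0 : f₁ U N * f₂ U N' = 0
  · rw [h0]; exact hRHS
  -- `Z := N ∩ N'`
  set Z : Finset V := U.filter fun u => u ∈ N ∧ u ∈ N' with hZ
  have hZU : Z ⊆ U := Finset.filter_subset _ _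
  have hmemZ : ∀ u, u ∈ Z ↔ u ∈ N ∧ u ∈ N' := fun u => by
    simp only [hZ, Finset.mem_filter, and_iff_right_iff_imp]
    exact fun h => hNU h.1
  have hZN : (↑Z : Set V) ⊆ N := fun u hu => ((hmemZ u).1 hu).1
  have hZN' : (↑Z : Set V) ⊆ N' := fun u hu => ((hmemZ u).1 hu).2
  have hNN'Z : N ∩ N' = ↑Z := Set.ext fun u => by
    rw [Finset.mem_coe, hmemZ]; rfl
  have hAdm : Adm U Z := hadm U le_rfl N N' hNU hN'U h0 Z hZU (by rw [hNN'Z])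
  rcases Z.eq_empty_or_nonempty with hZe | hZne
  · -- `N ∩ N' = ∅`: the disjoint-sources hypothesis
    have hNN' : N ∩ N' = ∅ := by rw [hNN'Z, hZe, Finset.coe_empty]
    rw [hNN']
    exact hbase U le_rfl N N' hNU hN'U hNN'
  · /- `Z ≠ ∅`: condition on the neighbour set `S` of `Z`, push forward to its product law, and apply the
    four functions theorem with the induction hypothesis on `U ∖ Z`. -/
    have hss : U \ Z ⊂ U := Finset.sdiff_ssubset hZU hZne
    have hU'U : U \ Z ⊆ U := Finset.sdiff_subset
    have hZNN' : (↑Z : Set V) ⊆ N ∪ N' := hZN.trans Set.subset_union_left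
    have hNuU : N ∪ N' ⊆ ↑U := Set.union_subset hNU hN'U
    -- star decompositions
    have e₁ := hstep₁ U le_rfl Z hZU hAdm hZne N hZN hNU
    have e₂ := hstep₂ U le_rfl Z hZU hAdm hZne N' hZN' hN'U
    have e₃ := hstep₃ U le_rfl Z hZU hAdm hZne (N ∪ N') hZNN' hNuU
    have e₄ : f₄ U (N ∩ N') = ∑ ω, weight w ω * f₄ (U \ Z) (rS U Z ω) := by
      rw [hNN'Z, hstep₄ U le_rfl Z hZU hAdm hZne (↑Z : Set V) subset_rfl (fun u hu => hZU hu)]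
      simp only [Set.sdiff_self, Set.empty_union]
    -- the four functionals on the lattice `Set V`
    set e : Set V → ℝ := fun η => f₁ (U \ Z) (N \ ↑Z ∪ (η ∩ ↑(U \ Z))) with he
    set y : Set V → ℝ := fun η => f₂ (U \ Z) (N' \ ↑Z ∪ (η ∩ ↑(U \ Z))) with hy
    set m : Set V → ℝ := fun η => f₃ (U \ Z) ((N ∪ N') \ ↑Z ∪ (η ∩ ↑(U \ Z))) with hm'
    set χ : Set V → ℝ := fun η => f₄ (U \ Z) (η ∩ ↑(U \ Z)) with hχ
    set wp : Set V → ℝ := weight (pZ w U Z) with hwp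
    have hrSU : ∀ ω : Set (Sym2 V), rS U Z ω ∩ ↑(U \ Z) = rS U Z ω := fun ω =>
      Set.inter_eq_left.2 (rS_subset U Z ω)
    have hE' : f₁ U N = ∑ η, wp η * e η := by
      rw [e₁, ← sum_weight_rS hm U Z e]
      refine Finset.sum_congr rfl fun ω _ => ?_
      simp only [he, hrSU]
    have hY' : f₂ U N' = ∑ η, wp η * y η := by
      rw [e₂, ← sum_weight_rS hm U Z y]
      refine Finset.sum_congr rfl fun ω _ => ?_
      simp only [hy, hrSU]
    have hM' : f₃ U (N ∪ N') = ∑ η, wp η * m η := by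
      rw [e₃, ← sum_weight_rS hm U Z m]
      refine Finset.sum_congr rfl fun ω _ => ?_
      simp only [hm', hrSU]
    have hX' : f₄ U (N ∩ N') = ∑ η, wp η * χ η := by
      rw [e₄, ← sum_weight_rS hm U Z χ]
      refine Finset.sum_congr rfl fun ω _ => ?_
      simp only [hχ, hrSU]
    -- nonnegativity
    have hp0 : ∀ u, 0 ≤ pZ w U Z u := fun u => (pZ_mem hw0 hw1 hm U Z u).1
    have hp1 : ∀ u, pZ w U Z u ≤ 1 := fun u => (pZ_mem hw0 hw1 hm U Z u).2
    have hwp0 : ∀ η, 0 ≤ wp η := fun η => weight_nonneg hp0 hp1 η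
    have he0 : ∀ η, 0 ≤ e η := fun η => h₁ _ _
    have hy0 : ∀ η, 0 ≤ y η := fun η => h₂ _ _
    have hm0 : ∀ η, 0 ≤ m η := fun η => h₃ _ _
    have hχ0 : ∀ η, 0 ≤ χ η := fun η => h₄ _ _
    -- the induction hypothesis in `U ∖ Z` (all hypotheses restrict to sub-worlds of `U ∖ Z`)
    have IH := ih (U \ Z) hss
      (fun U'' hU'' => hadm U'' (hU''.trans hU'U)) (fun U'' hU'' => hstep₁ U'' (hU''.trans hU'U))
      (fun U'' hU'' => hstep₂ U'' (hU''.trans hU'U)) (fun U'' hU'' => hstep₃ U'' (hU''.trans hU'U))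
      (fun U'' hU'' => hstep₄ U'' (hU''.trans hU'U)) (fun U'' hU'' => hanti₁ U'' (hU''.trans hU'U))
      (fun U'' hU'' => hanti₂ U'' (hU''.trans hU'U)) (fun U'' hU'' => hbase U'' (hU''.trans hU'U))
    have keyZ : ∀ u, u ∈ N → u ∈ N' → u ∈ (↑Z : Set V) := fun u h1 h2 => (hmemZ u).2 ⟨h1, h2⟩
    rw [hE', hY', hM', hX', mul_comm (∑ η, wp η * m η)]
    refine four_functions_theorem_univ (fun η => wp η * e η) (fun η => wp η * y η)
      (fun η => wp η * χ η) (fun η => wp η * m η)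
      (fun η => mul_nonneg (hwp0 η) (he0 η)) (fun η => mul_nonneg (hwp0 η) (hy0 η))
      (fun η => mul_nonneg (hwp0 η) (hχ0 η)) (fun η => mul_nonneg (hwp0 η) (hm0 η)) fun a b => ?_
    -- the Ahlswede–Daykin hypothesis from the induction hypothesis at the pair `(P, P')`
    set S' : Set V := a ∩ ↑(U \ Z) with hS'
    set T' : Set V := b ∩ ↑(U \ Z) with hT'
    set P : Set V := S' ∪ (N \ ↑Z) \ T' with hP
    set P' : Set V := T' ∪ (N' \ ↑Z) \ S' with hP'
    have hPU : P ⊆ ↑(U \ Z) := by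
      rintro u (hu | ⟨⟨huN, huZ⟩, -⟩)
      · exact hu.2
      · rw [Finset.coe_sdiff]; exact ⟨hNU huN, huZ⟩
    have hP'U : P' ⊆ ↑(U \ Z) := by
      rintro u (hu | ⟨⟨huN, huZ⟩, -⟩)
      · exact hu.2
      · rw [Finset.coe_sdiff]; exact ⟨hN'U huN, huZ⟩
    have hIH := IH P P' hPU hP'U
    have h1 : e a ≤ f₁ (U \ Z) P :=
      hanti₁ (U \ Z) hU'U P (N \ ↑Z ∪ S') (by rintro u (hu | ⟨hu, -⟩); exacts [Or.inr hu, Or.inl hu])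
        (by
          rintro u (⟨huN, huZ⟩ | hu)
          · rw [Finset.coe_sdiff]; exact ⟨hNU huN, huZ⟩
          · exact hu.2)
    have h2 : y b ≤ f₂ (U \ Z) P' :=
      hanti₂ (U \ Z) hU'U P' (N' \ ↑Z ∪ T') (by rintro u (hu | ⟨hu, -⟩); exacts [Or.inr hu, Or.inl hu])
        (by
          rintro u (⟨huN, huZ⟩ | hu)
          · rw [Finset.coe_sdiff]; exact ⟨hN'U huN, huZ⟩
          · exact hu.2)
    have hunion : P ∪ P' = (N ∪ N') \ ↑Z ∪ ((a ∪ b) ∩ ↑(U \ Z)) := by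
      ext u
      constructor
      · rintro ((hS | ⟨hA, -⟩) | (hT | ⟨hA', -⟩))
        · exact Or.inr ⟨Or.inl hS.1, hS.2⟩
        · exact Or.inl ⟨Or.inl hA.1, hA.2⟩
        · exact Or.inr ⟨Or.inr hT.1, hT.2⟩
        · exact Or.inl ⟨Or.inr hA'.1, hA'.2⟩
      · rintro (⟨hN | hN', hZ'⟩ | ⟨ha | hb, hU⟩)
        · by_cases hT : u ∈ T'
          · exact Or.inr (Or.inl hT)
          · exact Or.inl (Or.inr ⟨⟨hN, hZ'⟩, hT⟩)
        · by_cases hS : u ∈ S'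
          · exact Or.inl (Or.inl hS)
          · exact Or.inr (Or.inr ⟨⟨hN', hZ'⟩, hS⟩)
        · exact Or.inl (Or.inl ⟨ha, hU⟩)
        · exact Or.inr (Or.inl ⟨hb, hU⟩)
    have hinter : P ∩ P' = (a ∩ b) ∩ ↑(U \ Z) := by
      ext u
      constructor
      · rintro ⟨hS | ⟨⟨hN, hZ'⟩, hT⟩, hT' | ⟨⟨hN', -⟩, hS'⟩⟩
        · exact ⟨⟨hS.1, hT'.1⟩, hS.2⟩
        · exact absurd hS hS'
        · exact absurd hT' hT
        · exact absurd (keyZ u hN hN') hZ'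
      · rintro ⟨⟨ha, hb⟩, hU⟩
        exact ⟨Or.inl ⟨ha, hU⟩, Or.inl ⟨hb, hU⟩⟩
    have h3 : e a * y b ≤ m (a ∪ b) * χ (a ∩ b) :=
      calc e a * y b ≤ f₁ (U \ Z) P * f₂ (U \ Z) P' := mul_le_mul h1 h2 (hy0 b) (h₁ _ _)
        _ ≤ f₃ (U \ Z) (P ∪ P') * f₄ (U \ Z) (P ∩ P') := hIH
        _ = m (a ∪ b) * χ (a ∩ b) := by rw [hunion, hinter]
    have hwab := weight_inter_mul_union (pZ w U Z) a b
    show wp a * e a * (wp b * y b) ≤ wp (a ∩ b) * χ (a ∩ b) * (wp (a ∪ b) * m (a ∪ b))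
    calc wp a * e a * (wp b * y b) = (wp a * wp b) * (e a * y b) := by ring
      _ ≤ (wp (a ∩ b) * wp (a ∪ b)) * (m (a ∪ b) * χ (a ∩ b)) := by
          rw [hwp, hwab]
          exact mul_le_mul_of_nonneg_left h3 (mul_nonneg (hwp0 _) (hwp0 _))
      _ = _ := by ring

end Summit.CriticalPhenomena.PercolationContinuityZ3.Theorems.CovTau
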